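import Mathlib
import HarnessLib
import Summits.ValiantsHypothesis.ValiantsHypothesis.Theses.MonotoneRestoration
import Literature.Computability.AlgebraicComplexity.ArithCircuit
import Literature.Computability.AlgebraicComplexity.ArithCircuitProofs
import Literature.Computability.AlgebraicComplexity.MonotoneStructure
import Literature.Computability.AlgebraicComplexity.PermanentIrreducible
import Literature.ModelTheory.FiniteModelTheory.CkEquiv
import Summits.ValiantsHypothesis.ValiantsHypothesis.Theorems.MonotoneRestorationMonotoneRestorationQPCosetCount
import Summits.ValiantsHypothesis.ValiantsHypothesis.Theorems.MonotoneRestorationMonotoneRestorationQPSymmetricLB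
import Summits.ValiantsHypothesis.ValiantsHypothesis.Theorems.MonotoneRestorationMonotoneRestorationQPSupportSymmetrisation
import Summits.ValiantsHypothesis.ValiantsHypothesis.Theorems.MonotoneRestorationMonotoneRestorationQPSparseRegime
import Summits.ValiantsHypothesis.ValiantsHypothesis.Theorems.MonotoneRestorationMonotoneRestorationQPBeta
import Literature.Computability.AlgebraicComplexity.SymmetricArithCircuit
import Literature.Computability.AlgebraicComplexity.DawarWilsenach2025Proofs
import Literature.GroupTheory.PermutationGroups.SmallIndexSubgroups
import Summits.ValiantsHypothesis.ValiantsHypothesis.Theorems.MonotoneRestorationQP.Negative.LoadBearing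
import Summits.ValiantsHypothesis.ValiantsHypothesis.Theorems.MonotoneRestorationMonotoneRestorationQPPermSupportCount


/-! TTRL-lite variant V20103 of stmt-ValiantsHypothesis-15886

Target `stub_gateSupport` (slug `valian15886-stub-gatesupport`), move `lemma_proposal`: the
"intersection closure of alternating pointwise stabilisers WITHOUT a room condition" — if a subgroup
`S ≤ Sym(Fin n)` contains every even permutation fixing `X` pointwise and every even permutation
fixing `X'` pointwise, then it contains every even permutation fixing `X ∩ X'` pointwise — is FALSE.
Witness: `n = 3`, `S = ⊥`, `X = {0}`, `X' = {1}`: an even permutation of `Fin 3` fixing a point is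
the identity, so both hypotheses hold for `S = ⊥`, but `X ∩ X' = ∅` and the `3`-cycle
`(0 1)(1 2)` is even and non-trivial. (The proved neighbour V20041 shows the statement does hold
under the room condition `(X ∪ X').card + 3 ≤ n`.)
-/

-- `Summit.ValiantsHypothesis.ValiantsHypothesis.…` is the tree's mandated single-conjunct layout
-- (Sub = Summit), so the duplicated namespace component is intended.
set_option linter.dupNamespace false

namespace Summit.ValiantsHypothesis.ValiantsHypothesis.Theorems

open Summit.ValiantsHypothesis.ValiantsHypothesis.Theses.MonotoneRestoration
open Literature.Computability.AlgebraicComplexity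

/-- **TTRL-lite variant V20103 of `stub_gateSupport` is FALSE** (intersection of alternating
supports without a room condition). Witness: `n = 3`, `S = ⊥`, `X = {0}`, `X' = {1}`,
`ρ = (0 1)(1 2)`. Every even permutation of `Fin 3` fixing one point is the identity (the only
other permutation fixing it is a transposition, which is odd), so `⊥` contains all even permutations
fixing `{0}` (resp. `{1}`) pointwise; but `{0} ∩ {1} = ∅`, and the `3`-cycle `(0 1)(1 2)` is even and
`≠ 1`, hence not in `⊥`. The room condition `(X ∪ X').card + 3 ≤ n` of V20041 is therefore needed. -/
theorem stub_gateSupport_var20103_false :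
    ¬ (∀ (n : ℕ) (S : Subgroup (Equiv.Perm (Fin n))) (X X' : Finset (Fin n)),
        (∀ ρ : Equiv.Perm (Fin n), (∀ x ∈ X, ρ x = x) → Equiv.Perm.sign ρ = 1 → ρ ∈ S) →
        (∀ ρ : Equiv.Perm (Fin n), (∀ x ∈ X', ρ x = x) → Equiv.Perm.sign ρ = 1 → ρ ∈ S) →
        ∀ ρ : Equiv.Perm (Fin n), (∀ x ∈ X ∩ X', ρ x = x) → Equiv.Perm.sign ρ = 1 → ρ ∈ S) := by
  intro h
  -- an even permutation of `Fin 3` fixing a point is the identity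
  have key : ∀ (a : Fin 3) (ρ : Equiv.Perm (Fin 3)), ρ a = a → Equiv.Perm.sign ρ = 1 → ρ = 1 := by
    decide
  have hX : ∀ ρ : Equiv.Perm (Fin 3), (∀ x ∈ ({0} : Finset (Fin 3)), ρ x = x) →
      Equiv.Perm.sign ρ = 1 → ρ ∈ (⊥ : Subgroup (Equiv.Perm (Fin 3))) :=
    fun ρ hρ hs => Subgroup.mem_bot.2 (key 0 ρ (hρ 0 (Finset.mem_singleton_self 0)) hs)
  have hX' : ∀ ρ : Equiv.Perm (Fin 3), (∀ x ∈ ({1} : Finset (Fin 3)), ρ x = x) →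
      Equiv.Perm.sign ρ = 1 → ρ ∈ (⊥ : Subgroup (Equiv.Perm (Fin 3))) :=
    fun ρ hρ hs => Subgroup.mem_bot.2 (key 1 ρ (hρ 1 (Finset.mem_singleton_self 1)) hs)
  -- the even `3`-cycle `(0 1)(1 2)` fixes `{0} ∩ {1} = ∅` pointwise but is not the identity
  have hfix : ∀ x ∈ ({0} : Finset (Fin 3)) ∩ {1},
      (Equiv.swap (0 : Fin 3) 1 * Equiv.swap 1 2 : Equiv.Perm (Fin 3)) x = x := by
    decide
  have hsign : Equiv.Perm.sign (Equiv.swap (0 : Fin 3) 1 * Equiv.swap 1 2) = 1 := by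
    rw [Equiv.Perm.sign_mul, Equiv.Perm.sign_swap (by decide), Equiv.Perm.sign_swap (by decide)]
    decide
  have h3 := h 3 ⊥ {0} {1} hX hX' _ hfix hsign
  rw [Subgroup.mem_bot] at h3
  exact absurd h3 (by decide)

end Summit.ValiantsHypothesis.ValiantsHypothesis.Theorems
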